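import Mathlib.GroupTheory.Index
import Mathlib.GroupTheory.QuotientGroup.Basic
import Mathlib.GroupTheory.OrderOfElement
import Mathlib.Tactic.Abel
import HarnessLib

/-!
# Kramer–Tunnell 1982, §6: the norm index through `0 → E⁰ → E → Φ → 0` (cohomology of a group
of order `2`, elementary form)

K. Kramer, J. Tunnell, *Elliptic curves and local ε-factors*, Compositio Math. **46** (1982),
§6 (p. 327), set-up of Lemma 6.1: "It follows from Lang's theorem [9] that `N : E⁰(K) → E⁰(F)`
is surjective.  Let `X` be the 2-Sylow subgroup of `E(K)/E⁰(K)`.  Let `G = Gal(K/F)`.  Then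
`E(F)/NE(K) ≅ Ĥ⁰(G, X)`."  This file proves the homological algebra behind that sentence, for an
abelian group `B` with an involution `σ` (a `G = ℤ/2`-module), a `σ`-stable subgroup `A` and the
quotient `C = B/A` with the induced involution `σ̄ = QuotientAddGroup.map A A σ _` — in the
elementary vocabulary of the tree's `KramerTunnell1982/UnramifiedNormIndex`
(`Ĥ⁰ = fixed / norms = (1 + σ).range.relIndex (σ.eqLocus 1)`, `H¹ = ker (1 + σ) / im (σ - 1)`):

* `relIndex_norm_fixed_eq_quotient` — if `Ĥ⁰(A) = H¹(A) = 0` then `[B^σ : N B] = [C^σ̄ : N C]`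
  (the exact hexagon of a cyclic group, Serre *Local Fields* VIII §4);
* `exists_fixed_lift`, `exists_add_eq_of_quotient` — its two pointwise halves (every `σ̄`-fixed
  class lifts to a `σ`-fixed element when `H¹(A) = 0`; a fixed element whose class is a norm is a
  norm when `Ĥ⁰(A) = 0`); `quotient_exists_add_eq` — `Ĥ⁰(B) = 0 ⇒ Ĥ⁰(C) = 0` when `H¹(A) = 0`;
* `exists_sub_eq_of_quotient`, `quotient_exists_sub_eq` — the `H¹` companions
  (`H¹(A) = H¹(C) = 0 ⇒ H¹(B) = 0`; `Ĥ⁰(A) = 0 ∧ H¹(B) = 0 ⇒ H¹(C) = 0`);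
* `exists_add_eq_of_odd_card`, `exists_sub_eq_of_odd_card` — a finite module of odd order has
  `Ĥ⁰ = H¹ = 0` (so only the 2-Sylow subgroup `X` of `Φ` matters);
* §4 `…_of_surjective` — the same transfer statements along an equivariant surjection
  `π : B → C` with cohomologically trivial kernel (for `0 → E₁ → E⁰(K) → Ẽ_ns(k) → 0`).

Theorems only: no definition, no named fact, no `sorry` (D-0026: net debt `0`).

## References

* [KramerTunnell1982] K. Kramer, J. Tunnell, Compositio Math. 46 (1982), §6 p. 327
  (`E(F)/NE(K) ≅ Ĥ⁰(G, X)`).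
* [SerreLocalFields1979] J.-P. Serre, *Local Fields*, GTM 67, Ch. VIII §4 (the exact hexagon of a
  cyclic group; Prop. 7 and Prop. 8).
-/

namespace Literature.NumberTheory.EllipticCurves.KramerTunnell1982

section Module

variable {B : Type*} [AddCommGroup B] (σ : B →+ B) (A : AddSubgroup B) (hA : A ≤ A.comap σ)

/-! ## §1 Pointwise transfer along `0 → A → B → B/A → 0` -/

/-- The induced involution `σ̄` on `B/A` acts on classes by `σ̄ [b] = [σ b]` (unfolding).
[folklore] -/
private theorem map_mk (b : B) :
    QuotientAddGroup.map A A σ hA (QuotientAddGroup.mk b) = QuotientAddGroup.mk (σ b) := rfl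

/-- **Every `σ̄`-fixed class lifts to a `σ`-fixed element when `H¹(A) = 0`**: if `σ̄ c = c` then
`c = [b]` with `σ b = b` (lift `b₀`; `σ b₀ - b₀ ∈ A` has norm `0`, so it is `σ a - a`, and
`b = b₀ - a`).  The surjectivity half of `B^σ/NB ≅ (B/A)^σ̄/N(B/A)` (Serre, *Local Fields*,
VIII §4, exact hexagon, at `H¹(A) = 0`). [cite: SerreLocalFields1979, Ch. VIII §4 (exact hexagon)] -/
theorem exists_fixed_lift (hσσ : ∀ b, σ (σ b) = b)
    (h1A : ∀ a ∈ A, a + σ a = 0 → ∃ a' ∈ A, σ a' - a' = a)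
    {c : B ⧸ A} (hc : QuotientAddGroup.map A A σ hA c = c) :
    ∃ b : B, σ b = b ∧ (QuotientAddGroup.mk b : B ⧸ A) = c := by
  obtain ⟨b₀, rfl⟩ := QuotientAddGroup.mk_surjective c
  rw [map_mk, QuotientAddGroup.eq] at hc
  have hmem : σ b₀ - b₀ ∈ A := by
    have h := A.neg_mem hc
    rwa [neg_add, neg_neg, ← sub_eq_add_neg] at h
  obtain ⟨a, haA, ha⟩ := h1A _ hmem (by rw [map_sub, hσσ]; abel)
  refine ⟨b₀ - a, ?_, ?_⟩
  · rw [map_sub]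
    have h : σ a = a + (σ b₀ - b₀) := by rw [← ha]; abel
    rw [h]; abel
  · rw [QuotientAddGroup.eq]
    have h : -(b₀ - a) + b₀ = a := by abel
    rw [h]; exact haA

/-- **A `σ`-fixed element whose class is a norm is a norm, when `Ĥ⁰(A) = 0`**: if `σ b = b` and
`[b] = [x] + σ̄ [x]` then `b - (x + σ x) ∈ A` is `σ`-fixed, hence `= a + σ a`, and
`b = (x + a) + σ (x + a)`.  The injectivity half of `B^σ/NB ≅ (B/A)^σ̄/N(B/A)` (Serre,
*Local Fields*, VIII §4, exact hexagon, at `Ĥ⁰(A) = 0`). [cite: SerreLocalFields1979, Ch. VIII §4 (exact hexagon)] -/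
theorem exists_add_eq_of_quotient (hσσ : ∀ b, σ (σ b) = b)
    (h0A : ∀ a ∈ A, σ a = a → ∃ a' ∈ A, a' + σ a' = a)
    {b : B} (hb : σ b = b)
    (hc : ∃ x : B ⧸ A, x + QuotientAddGroup.map A A σ hA x = QuotientAddGroup.mk b) :
    ∃ y : B, y + σ y = b := by
  obtain ⟨x, hx⟩ := hc
  obtain ⟨x₀, rfl⟩ := QuotientAddGroup.mk_surjective x
  rw [map_mk, ← QuotientAddGroup.mk_add, QuotientAddGroup.eq] at hx
  obtain ⟨a, -, ha⟩ := h0A _ hx (by rw [map_add, map_neg, map_add, hσσ, hb, add_comm (σ x₀) x₀])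
  refine ⟨x₀ + a, ?_⟩
  rw [map_add]
  calc x₀ + a + (σ x₀ + σ a) = (x₀ + σ x₀) + (a + σ a) := by abel
    _ = b := by rw [ha]; abel

/-- **`Ĥ⁰(B) = 0` implies `Ĥ⁰(B/A) = 0` when `H¹(A) = 0`**: a `σ̄`-fixed class lifts to a fixed
`b = y + σ y` (`exists_fixed_lift`), so it is the norm `[y] + σ̄ [y]`.
[cite: SerreLocalFields1979, Ch. VIII §4 (exact hexagon)] -/
theorem quotient_exists_add_eq (hσσ : ∀ b, σ (σ b) = b)
    (h1A : ∀ a ∈ A, a + σ a = 0 → ∃ a' ∈ A, σ a' - a' = a)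
    (h0B : ∀ b : B, σ b = b → ∃ y : B, y + σ y = b)
    {c : B ⧸ A} (hc : QuotientAddGroup.map A A σ hA c = c) :
    ∃ x : B ⧸ A, x + QuotientAddGroup.map A A σ hA x = c := by
  obtain ⟨b, hb, rfl⟩ := exists_fixed_lift σ A hA hσσ h1A hc
  obtain ⟨y, rfl⟩ := h0B b hb
  exact ⟨QuotientAddGroup.mk y, by rw [map_mk, ← QuotientAddGroup.mk_add]⟩

/-- **`H¹(A) = 0` and `H¹(B/A) = 0` imply `H¹(B) = 0`**: if `b + σ b = 0` then `b = σ y - y`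
(`[b] = σ̄ [x] - [x]`, and `b - (σ x - x) ∈ A` has norm `0`).  Serre, *Local Fields*, VIII §4,
exact hexagon. [cite: SerreLocalFields1979, Ch. VIII §4 (exact hexagon)] -/
theorem exists_sub_eq_of_quotient (hσσ : ∀ b, σ (σ b) = b)
    (h1A : ∀ a ∈ A, a + σ a = 0 → ∃ a' ∈ A, σ a' - a' = a)
    (h1C : ∀ c : B ⧸ A, c + QuotientAddGroup.map A A σ hA c = 0 →
      ∃ c' : B ⧸ A, QuotientAddGroup.map A A σ hA c' - c' = c)
    {b : B} (hb : b + σ b = 0) : ∃ y : B, σ y - y = b := by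
  obtain ⟨c', hc'⟩ := h1C (QuotientAddGroup.mk b)
    (by rw [map_mk, ← QuotientAddGroup.mk_add, hb, QuotientAddGroup.mk_zero])
  obtain ⟨x, rfl⟩ := QuotientAddGroup.mk_surjective c'
  rw [map_mk, ← QuotientAddGroup.mk_sub, QuotientAddGroup.eq] at hc'
  obtain ⟨a, -, ha⟩ := h1A _ hc' (by
    rw [map_add, map_neg, map_sub, hσσ]
    calc -(σ x - x) + b + (-(x - σ x) + σ b) = b + σ b := by abel
      _ = 0 := hb)
  refine ⟨x + a, ?_⟩
  rw [map_add]
  calc σ x + σ a - (x + a) = (σ x - x) + (σ a - a) := by abel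
    _ = b := by rw [ha]; abel

/-- **`Ĥ⁰(A) = 0` and `H¹(B) = 0` imply `H¹(B/A) = 0`**: if `c + σ̄ c = 0`, `c = [b]`, then
`b + σ b ∈ A` is fixed, hence a norm `a + σ a`, `(b - a) + σ(b - a) = 0`, `b - a = σ y - y` and
`c = σ̄ [y] - [y]`.  Serre, *Local Fields*, VIII §4, exact hexagon.
[cite: SerreLocalFields1979, Ch. VIII §4 (exact hexagon)] -/
theorem quotient_exists_sub_eq (hσσ : ∀ b, σ (σ b) = b)
    (h0A : ∀ a ∈ A, σ a = a → ∃ a' ∈ A, a' + σ a' = a)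
    (h1B : ∀ b : B, b + σ b = 0 → ∃ y : B, σ y - y = b)
    {c : B ⧸ A} (hc : c + QuotientAddGroup.map A A σ hA c = 0) :
    ∃ x : B ⧸ A, QuotientAddGroup.map A A σ hA x - x = c := by
  obtain ⟨b, rfl⟩ := QuotientAddGroup.mk_surjective c
  rw [map_mk, ← QuotientAddGroup.mk_add, QuotientAddGroup.eq_zero_iff] at hc
  obtain ⟨a, haA, ha⟩ := h0A _ hc (by rw [map_add, hσσ, add_comm])
  obtain ⟨y, hy⟩ := h1B (b - a) (by
    rw [map_sub]
    calc b - a + (σ b - σ a) = (b + σ b) - (a + σ a) := by abel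
      _ = 0 := by rw [ha, sub_self])
  refine ⟨QuotientAddGroup.mk y, ?_⟩
  rw [map_mk, ← QuotientAddGroup.mk_sub, hy, QuotientAddGroup.eq]
  have h : -(b - a) + b = a := by abel
  rw [h]; exact haA

/-! ## §2 The norm index is unchanged modulo a cohomologically trivial subgroup -/

/-- **`[B^σ : N B] = [(B/A)^σ̄ : N(B/A)]` when `Ĥ⁰(A) = H¹(A) = 0`** (`σ` an involution of the
abelian group `B`, `A` a `σ`-stable subgroup): the reduction map `B^σ → (B/A)^σ̄` is onto
(`exists_fixed_lift`) and pulls `N(B/A)` back to `N B` (`exists_add_eq_of_quotient`), so the two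
indices agree (Mathlib `AddSubgroup.index_comap_of_surjective`; both are `0` if infinite).  This is
the step "`N : E⁰(K) → E⁰(F)` is surjective [and `H¹(G, E⁰(K)) = 0`] … Then
`E(F)/NE(K) ≅ Ĥ⁰(G, E(K)/E⁰(K))`" of Kramer–Tunnell, via the exact hexagon of
Serre, *Local Fields*, VIII §4. [cite: KramerTunnell1982, §6 p. 327 (E(F)/NE(K) ≅ Ĥ⁰(G, X))] -/
theorem relIndex_norm_fixed_eq_quotient (hσσ : ∀ b, σ (σ b) = b)
    (h0A : ∀ a ∈ A, σ a = a → ∃ a' ∈ A, a' + σ a' = a)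
    (h1A : ∀ a ∈ A, a + σ a = 0 → ∃ a' ∈ A, σ a' - a' = a) :
    (AddMonoidHom.id B + σ).range.relIndex (σ.eqLocus (AddMonoidHom.id B)) =
      (AddMonoidHom.id (B ⧸ A) + QuotientAddGroup.map A A σ hA).range.relIndex
        ((QuotientAddGroup.map A A σ hA).eqLocus (AddMonoidHom.id (B ⧸ A))) := by
  set τ := QuotientAddGroup.map A A σ hA with hτ
  set FB := σ.eqLocus (AddMonoidHom.id B) with hFB
  set FC := τ.eqLocus (AddMonoidHom.id (B ⧸ A)) with hFC
  -- the reduction map `B^σ → (B/A)^τ`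
  have hmem : ∀ b : FB, (QuotientAddGroup.mk (b : B) : B ⧸ A) ∈ FC := fun b => by
    have hb : σ b = b := b.2
    change τ (QuotientAddGroup.mk (b : B)) = QuotientAddGroup.mk (b : B)
    rw [hτ, map_mk, hb]
  let φ : FB →+ FC :=
    ((QuotientAddGroup.mk' A).comp FB.subtype).codRestrict FC hmem
  have hφ : ∀ b : FB, ((φ b : FC) : B ⧸ A) = QuotientAddGroup.mk (b : B) := fun b => rfl
  have hsurj : Function.Surjective φ := by
    intro c
    obtain ⟨b, hb, hbc⟩ := exists_fixed_lift σ A hA hσσ h1A (c := (c : B ⧸ A)) c.2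
    exact ⟨⟨b, hb⟩, Subtype.ext (by rw [hφ]; exact hbc)⟩
  have hcomap : ((AddMonoidHom.id (B ⧸ A) + τ).range.addSubgroupOf FC).comap φ =
      (AddMonoidHom.id B + σ).range.addSubgroupOf FB := by
    ext b
    simp only [AddSubgroup.mem_comap, AddSubgroup.mem_addSubgroupOf, AddMonoidHom.mem_range,
      AddMonoidHom.add_apply, AddMonoidHom.id_apply, hφ]
    constructor
    · intro h
      exact exists_add_eq_of_quotient σ A hA hσσ h0A b.2 h
    · rintro ⟨y, hy⟩
      exact ⟨QuotientAddGroup.mk y, by rw [hτ, map_mk, ← QuotientAddGroup.mk_add, hy]⟩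
  change ((AddMonoidHom.id B + σ).range.addSubgroupOf FB).index =
    ((AddMonoidHom.id (B ⧸ A) + τ).range.addSubgroupOf FC).index
  rw [← hcomap, AddSubgroup.index_comap_of_surjective _ hsurj]

end Module

/-! ## §3 Modules of odd order are cohomologically trivial

(`Nat.card C` odd; this forces `C` finite, Mathlib's `Nat.card` being `0` on infinite types.) -/

section Odd

variable {C : Type*} [AddCommGroup C] (τ : C →+ C)

/-- **`Ĥ⁰ = 0` for a module of odd order**: if `#C` is odd and `τ c = c` then `c = d + τ d` with
`d = -m • c`, `#C = 2m + 1` (so in `E(F)/NE(K) ≅ Ĥ⁰(G, X)` only the 2-Sylow subgroup `X` of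
`E(K)/E⁰(K)` matters: "For reductions of type I₀, I_v with v odd, II, II*, IV, IV*, c is odd …
Since X must be trivial, dim E(F)/NE(K) = 0").
[cite: KramerTunnell1982, §6 proof of Lemma 6.1 (p. 327), "c is odd … X must be trivial"] -/
theorem exists_add_eq_of_odd_card (hodd : Odd (Nat.card C)) {c : C} (hc : τ c = c) :
    ∃ d : C, d + τ d = c := by
  obtain ⟨m, hm⟩ := hodd
  have hcard : (Nat.card C) • c = 0 := card_nsmul_eq_zero'
  rw [hm, add_nsmul, one_nsmul, mul_nsmul'] at hcard
  refine ⟨-(m • c), ?_⟩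
  rw [map_neg, map_nsmul, hc]
  calc -(m • c) + -(m • c) = -(2 • (m • c)) := by rw [two_nsmul]; abel
    _ = c := (eq_neg_of_add_eq_zero_right hcard).symm

/-- **`H¹ = 0` for a module of odd order**: if `#C` is odd and `c + τ c = 0` then `c = τ d - d`
with `d = m • c`, `#C = 2m + 1`. [cite: KramerTunnell1982, §6 proof of Lemma 6.1 (p. 327), "c is odd … X must be trivial"] -/
theorem exists_sub_eq_of_odd_card (hodd : Odd (Nat.card C)) {c : C} (hc : c + τ c = 0) :
    ∃ d : C, τ d - d = c := by
  obtain ⟨m, hm⟩ := hodd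
  have hcard : (Nat.card C) • c = 0 := card_nsmul_eq_zero'
  rw [hm, add_nsmul, one_nsmul, mul_nsmul'] at hcard
  have hτc : τ c = -c := eq_neg_of_add_eq_zero_right hc
  refine ⟨m • c, ?_⟩
  rw [map_nsmul, hτc, neg_nsmul]
  calc -(m • c) - m • c = -(2 • (m • c)) := by rw [two_nsmul]; abel
    _ = c := (eq_neg_of_add_eq_zero_right hcard).symm

end Odd

/-! ## §4 The same along a surjection `π : B → C` (e.g. reduction `E⁰(K) → Ẽ_ns(k)`)

For Kramer–Tunnell's first step ("`N : E⁰(K) → E⁰(F)` is surjective" from Lang's theorem on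
`Ẽ_ns(k)` and the formal group) the exact sequence is `0 → E₁ → E⁰ → Ẽ_ns(k) → 0` with a
*surjection* `π` (reduction) that is not literally a quotient map; we restate §1–§2 for an
equivariant surjection `π : B →+ C` (`π ∘ s = t ∘ π`) with cohomologically trivial kernel. -/

section Surjection

variable {B C : Type*} [AddCommGroup B] [AddCommGroup C] (s : B →+ B) (t : C →+ C) (π : B →+ C)
  (hπ : ∀ b, π (s b) = t (π b))

include hπ

/-- **Fixed elements lift along an equivariant surjection with `H¹(ker) = 0`**: if `t c = c` then
`c = π b` with `s b = b`.  Serre, *Local Fields*, VIII §4 (exact hexagon, at `H¹(A) = 0`).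
[cite: SerreLocalFields1979, Ch. VIII §4 (exact hexagon)] -/
theorem exists_fixed_lift_of_surjective (hss : ∀ b, s (s b) = b) (hsurj : Function.Surjective π)
    (h1A : ∀ a, π a = 0 → a + s a = 0 → ∃ a', π a' = 0 ∧ s a' - a' = a)
    {c : C} (hc : t c = c) : ∃ b : B, s b = b ∧ π b = c := by
  obtain ⟨b₀, rfl⟩ := hsurj c
  have hmem : π (s b₀ - b₀) = 0 := by rw [map_sub, hπ, hc, sub_self]
  obtain ⟨a, haA, ha⟩ := h1A _ hmem (by rw [map_sub, hss]; abel)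
  refine ⟨b₀ - a, ?_, ?_⟩
  · rw [map_sub]
    have h : s a = a + (s b₀ - b₀) := by rw [← ha]; abel
    rw [h]; abel
  · rw [map_sub, haA, sub_zero]

/-- **A fixed element whose image is a norm is a norm, when `Ĥ⁰(ker) = 0`** (equivariant
surjection).  Serre, *Local Fields*, VIII §4 (exact hexagon, at `Ĥ⁰(A) = 0`).
[cite: SerreLocalFields1979, Ch. VIII §4 (exact hexagon)] -/
theorem exists_add_eq_of_surjective (hss : ∀ b, s (s b) = b) (hsurj : Function.Surjective π)
    (h0A : ∀ a, π a = 0 → s a = a → ∃ a', π a' = 0 ∧ a' + s a' = a)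
    {b : B} (hb : s b = b) (hc : ∃ y : C, y + t y = π b) : ∃ x : B, x + s x = b := by
  obtain ⟨y, hy⟩ := hc
  obtain ⟨x₀, rfl⟩ := hsurj y
  have hmem : π (b - (x₀ + s x₀)) = 0 := by rw [map_sub, map_add, hπ, hy, sub_self]
  obtain ⟨a, -, ha⟩ := h0A _ hmem (by rw [map_sub, map_add, hss, hb, add_comm (s x₀) x₀])
  refine ⟨x₀ + a, ?_⟩
  rw [map_add]
  calc x₀ + a + (s x₀ + s a) = (x₀ + s x₀) + (a + s a) := by abel
    _ = b := by rw [ha]; abel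

/-- **`Ĥ⁰(B) = 0 ⇒ Ĥ⁰(C) = 0`** along an equivariant surjection with `H¹(ker) = 0`.
[cite: SerreLocalFields1979, Ch. VIII §4 (exact hexagon)] -/
theorem exists_add_eq_image_of_surjective (hss : ∀ b, s (s b) = b)
    (hsurj : Function.Surjective π)
    (h1A : ∀ a, π a = 0 → a + s a = 0 → ∃ a', π a' = 0 ∧ s a' - a' = a)
    (h0B : ∀ b : B, s b = b → ∃ x : B, x + s x = b)
    {c : C} (hc : t c = c) : ∃ y : C, y + t y = c := by
  obtain ⟨b, hb, rfl⟩ := exists_fixed_lift_of_surjective s t π hπ hss hsurj h1A hc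
  obtain ⟨x, rfl⟩ := h0B b hb
  exact ⟨π x, by rw [map_add, hπ]⟩

/-- **`H¹(ker) = 0 ∧ H¹(C) = 0 ⇒ H¹(B) = 0`** along an equivariant surjection.
[cite: SerreLocalFields1979, Ch. VIII §4 (exact hexagon)] -/
theorem exists_sub_eq_of_surjective (hss : ∀ b, s (s b) = b) (hsurj : Function.Surjective π)
    (h1A : ∀ a, π a = 0 → a + s a = 0 → ∃ a', π a' = 0 ∧ s a' - a' = a)
    (h1C : ∀ c : C, c + t c = 0 → ∃ c' : C, t c' - c' = c)
    {b : B} (hb : b + s b = 0) : ∃ x : B, s x - x = b := by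
  obtain ⟨c', hc'⟩ := h1C (π b) (by rw [← hπ, ← map_add, hb, map_zero])
  obtain ⟨x, rfl⟩ := hsurj c'
  have hmem : π (b - (s x - x)) = 0 := by rw [map_sub, map_sub, hπ, hc', sub_self]
  obtain ⟨a, -, ha⟩ := h1A _ hmem (by
    rw [map_sub, map_sub, hss]
    calc b - (s x - x) + (s b - (x - s x)) = b + s b := by abel
      _ = 0 := hb)
  refine ⟨x + a, ?_⟩
  rw [map_add]
  calc s x + s a - (x + a) = (s x - x) + (s a - a) := by abel
    _ = b := by rw [ha]; abel

/-- **`Ĥ⁰(ker) = 0 ∧ H¹(B) = 0 ⇒ H¹(C) = 0`** along an equivariant surjection.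
[cite: SerreLocalFields1979, Ch. VIII §4 (exact hexagon)] -/
theorem exists_sub_eq_image_of_surjective (hss : ∀ b, s (s b) = b)
    (hsurj : Function.Surjective π)
    (h0A : ∀ a, π a = 0 → s a = a → ∃ a', π a' = 0 ∧ a' + s a' = a)
    (h1B : ∀ b : B, b + s b = 0 → ∃ x : B, s x - x = b)
    {c : C} (hc : c + t c = 0) : ∃ y : C, t y - y = c := by
  obtain ⟨b, rfl⟩ := hsurj c
  have hmem : π (b + s b) = 0 := by rw [map_add, hπ, hc]
  obtain ⟨a, haA, ha⟩ := h0A _ hmem (by rw [map_add, hss, add_comm])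
  obtain ⟨x, hx⟩ := h1B (b - a) (by
    rw [map_sub]
    calc b - a + (s b - s a) = (b + s b) - (a + s a) := by abel
      _ = 0 := by rw [ha, sub_self])
  refine ⟨π x, ?_⟩
  rw [← hπ, ← map_sub, hx, map_sub, haA, sub_zero]

/-- **`[B^s : N B] = [C^t : N C]` along an equivariant surjection whose kernel has
`Ĥ⁰ = H¹ = 0`** (both indices `0` if infinite): the surjection form of
`relIndex_norm_fixed_eq_quotient`, for Kramer–Tunnell's reduction sequence
`0 → E₁(K) → E⁰(K) → Ẽ_ns(k) → 0`. [cite: KramerTunnell1982, §6 p. 327 (E(F)/NE(K) ≅ Ĥ⁰(G, X))] -/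
theorem relIndex_norm_fixed_eq_of_surjective (hss : ∀ b, s (s b) = b)
    (hsurj : Function.Surjective π)
    (h0A : ∀ a, π a = 0 → s a = a → ∃ a', π a' = 0 ∧ a' + s a' = a)
    (h1A : ∀ a, π a = 0 → a + s a = 0 → ∃ a', π a' = 0 ∧ s a' - a' = a) :
    (AddMonoidHom.id B + s).range.relIndex (s.eqLocus (AddMonoidHom.id B)) =
      (AddMonoidHom.id C + t).range.relIndex (t.eqLocus (AddMonoidHom.id C)) := by
  set FB := s.eqLocus (AddMonoidHom.id B) with hFB
  set FC := t.eqLocus (AddMonoidHom.id C) with hFC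
  have hmem : ∀ b : FB, π (b : B) ∈ FC := fun b => by
    have hb : s b = b := b.2
    change t (π (b : B)) = π (b : B)
    rw [← hπ, hb]
  let φ : FB →+ FC := (π.comp FB.subtype).codRestrict FC hmem
  have hφ : ∀ b : FB, ((φ b : FC) : C) = π (b : B) := fun b => rfl
  have hφsurj : Function.Surjective φ := by
    intro c
    obtain ⟨b, hb, hbc⟩ :=
      exists_fixed_lift_of_surjective s t π hπ hss hsurj h1A (c := (c : C)) c.2
    exact ⟨⟨b, hb⟩, Subtype.ext (by rw [hφ]; exact hbc)⟩
  have hcomap : ((AddMonoidHom.id C + t).range.addSubgroupOf FC).comap φ =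
      (AddMonoidHom.id B + s).range.addSubgroupOf FB := by
    ext b
    simp only [AddSubgroup.mem_comap, AddSubgroup.mem_addSubgroupOf, AddMonoidHom.mem_range,
      AddMonoidHom.add_apply, AddMonoidHom.id_apply, hφ]
    constructor
    · intro h
      exact exists_add_eq_of_surjective s t π hπ hss hsurj h0A b.2 h
    · rintro ⟨x, hx⟩
      exact ⟨π x, by rw [← hπ, ← map_add, hx]⟩
  change ((AddMonoidHom.id B + s).range.addSubgroupOf FB).index =
    ((AddMonoidHom.id C + t).range.addSubgroupOf FC).index
  rw [← hcomap, AddSubgroup.index_comap_of_surjective _ hφsurj]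

end Surjection

end Literature.NumberTheory.EllipticCurves.KramerTunnell1982
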